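import Summits.HodgeConjecture.HodgeConjecture.Theses.LinearSystemTorelli
import Literature.AlgebraicGeometry.HodgeTheory.DivisorInduction
import Literature.AlgebraicGeometry.HodgeTheory.GysinKernelSplit
import Literature.AlgebraicGeometry.HodgeTheory.HodgeRiemannPolarizability
import Literature.AlgebraicGeometry.HodgeTheory.ComplexConjugationHolds
import Literature.NumberTheory.Transcendental.DeRhamTheoremMultiplicative

/-!
# Route LinearSystemTorelli — `DivisorInduction` (item stmt-HodgeConjecture-1082) modulo the two
# open LEAVES of the tree: Deligne, *Hodge III*, Prop. 8.2.7 and Hodge–Riemann polarizability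

Companion of `Theorems/LinearSystemTorelliDivisorInduction` (the item modulo the named facts
`Deligne1974_ker_restrictCompl_eq_iSup_range_complexGysin` = Hodge III Cor. 8.2.8 and
`Voisin2025_hodgeClass_lift_complexGysin` = Voisin 2025 Cor. 2.12). Both of those facts have been
decomposed in the Literature library down to ONE open leaf each, everything else being theorems:

* Cor. 8.2.8 ⟸ `Deligne1974_ker_pullback_eq_ker_pullback_resolution` (Hodge III **Prop. 8.2.7**:
  a class killed by the pull-backs to resolutions of the components of `Z` dies near `Z(ℂ)`; mixed
  Hodge theory — weights and strictness), by
  `Deligne1974_ker_restrictCompl_eq_iSup_range_complexGysin_holds_of` (`HodgeTheory/GysinKernelSplit`: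
  the Poincaré-duality transposition and the inclusion `⊇` are proved);
* Cor. 2.12 ⟸ `smoothProjective_hodgeStructure_isPolarizable` (**Hodge–Riemann bilinear relations**
  with the Lefschetz decomposition for a rational Kähler class, Voisin I Thm. 6.32 / 6.25 / §7.1.2),
  by `Voisin2025_hodgeClass_lift_complexGysin_holds_of` (`HodgeTheory/HodgeRiemannPolarizability`)
  fed with the THEOREMS `exists_isReal_hodgeModel_holds` (real Hodge models: GAGA, de Rham, the
  Hodge decomposition of compact Kähler manifolds — `HodgeTheory/ComplexConjugationHolds`) and
  `Literature.NumberTheory.Transcendental.exists_deRhamIsoFamily_holds` (de Rham's theorem in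
  multiplicative form — `Transcendental/DeRhamTheoremMultiplicative`).

So the item `DivisorInduction` holds modulo EXACTLY these two leaves; this file records that
statement against the route decl, so that the item's residual debt is visible by name. It does not
close the item.
-/

noncomputable section

namespace Summit.HodgeConjecture.HodgeConjecture.Theorems

/-- **Item stmt-HodgeConjecture-1082 (`DivisorInduction`), `LinearSystemTorelli` copy, modulo the
two open leaves** `Deligne1974_ker_pullback_eq_ker_pullback_resolution` (`h827`, Deligne Hodge III
Prop. 8.2.7) and `smoothProjective_hodgeStructure_isPolarizable` (`hpol`, Hodge–Riemann: the Hodge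
structure on `Hᵏ(Y(ℂ); ℚ)` of a smooth projective `Y` is polarizable): assemble Cor. 8.2.8 from
`h827` and Cor. 2.12 from `hpol` with the tree's theorems on real Hodge models and de Rham, then
apply the Literature theorem `divisorInduction_of_deligne_of_hodgeClassLift`. The conclusion is
literally the route decl. [cite: DeligneHodgeIII1974, Prop. 8.2.7 and Cor. 8.2.8]
[cite: VoisinHodgeI2002, Thm. 6.32 with Thm. 6.25, §7.1.2 and Lemma 7.26]
[cite: Voisin2025, Cor. 2.12 (p. 24)] -/
theorem linearSystemTorelli_divisorInduction_of_pullback_of_isPolarizable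
    (h827 : Literature.AlgebraicGeometry.HodgeTheory.Deligne1974_ker_pullback_eq_ker_pullback_resolution)
    (hpol : Literature.AlgebraicGeometry.HodgeTheory.smoothProjective_hodgeStructure_isPolarizable) :
    Summit.HodgeConjecture.HodgeConjecture.Theses.LinearSystemTorelli.DivisorInduction := by
  unfold Summit.HodgeConjecture.HodgeConjecture.Theses.LinearSystemTorelli.DivisorInduction
  exact Literature.AlgebraicGeometry.HodgeTheory.divisorInduction_of_deligne_of_hodgeClassLift
    (Literature.AlgebraicGeometry.HodgeTheory.Deligne1974_ker_restrictCompl_eq_iSup_range_complexGysin_holds_of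
      h827)
    (Literature.AlgebraicGeometry.HodgeTheory.Voisin2025_hodgeClass_lift_complexGysin_holds_of
      Literature.AlgebraicGeometry.HodgeTheory.exists_isReal_hodgeModel_holds
      (fun E _ _ _ ↦ Literature.NumberTheory.Transcendental.exists_deRhamIsoFamily_holds E) hpol)

end Summit.HodgeConjecture.HodgeConjecture.Theorems

end
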